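import Summits.PneNP.PneNP.Theorems.PeaTwoMemBPP.Negative.NoXiIndependentQuadraticEncoding

/-!
# PneNP / SzkEntropy — crux `PeaTwoMemBPP` (stmt-PneNP-10778), negative side: the no-exact-gadget theorem for sparse quadratic maps

Route `PneNP/SzkEntropy`, crux stmt-PneNP-10778.  Bridge from the tree's sparse presentation of polynomial maps
(`PolyMapF2`, syntactic degree bound `DegLE 2`: every monomial lists `≤ 2` variables) to the derivative-based
degree predicate `IsDeg2` of `QuadraticCharSums.lean`, and the resulting corollary of
`no_xi_independent_quadratic_encoding`:

* `polyVal p x` — the value of one sparse output polynomial (`PolyMapF2.eval P x = P.map (polyVal · x)`,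
  `eval_eq_map_polyVal`); `isDeg2_polyVal` / `isDeg2_of_degLE_two`: **every output of a `DegLE 2` map, and every
  `F₂`-combination of outputs, has vanishing third derivatives**; transport along the block-append map
  `appendHom : F₂³ × F₂ˢ →+ F₂^{3+s}` (`IsDeg2.comp_addMonoidHom`).
* `no_sparse_quadratic_gadget`: for sparse quadratic `Ap` (the replacement of the cubic monomial `ξ₀ξ₁ξ₂` in the
  `3+s` variables `(ξ,w)`) and `Bp₁,…,Bp_t` (the appended outputs), it is impossible that the outputs are
  jointly `ξ`-independent while `Ap = ξ₀ξ₁ξ₂ + c(Bp)` — the two properties that `Disproof.lean` THEOREM 10.1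
  derives from entropy-exactness on seven test maps.  So **no quadratic gadget replaces a cubic monomial with a
  map-independent entropy offset**, whatever `s` and `t`: the signed eight-map identity of
  `RenyiAndSignedDegreeReduction.lean` cannot be shortened to one map, and `PEA₃ ≤ PEA₂` is not provable by
  local gadgets.

References: Z. Dvir, D. Gutfreund, G. N. Rothblum, S. Vadhan, *On approximating the entropy of polynomial
mappings*, ICS 2011 (ECCC TR10-160), §2 (sparse polynomial maps), Thm 4.5–4.7; F. J. MacWilliams,
N. J. A. Sloane, *The Theory of Error-Correcting Codes*, Ch. 13 §3 (Reed–Muller codes: degree via derivatives).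
-/

namespace Summit.PneNP.PneNP.Theorems.PeaTwoMemBPP.Negative

open Finset

/-! ### From sparse quadratic maps (`PolyMapF2`, `DegLE 2`) to `IsDeg2`, and the gadget corollary -/

section Sparse

open Literature.Computability.Complexity

variable {n : ℕ}

/-- The value at `x` of one sparse output polynomial (list of monomials = lists of variable indices): the
per-coordinate formula of `PolyMapF2.eval`. [DvirGutfreundRothblumVadhan2010, §2] -/
def polyVal (p : List (List (Fin n))) (x : Fin n → ZMod 2) : ZMod 2 :=
  (p.map fun μ => (μ.map x).prod).sum

/-- `PolyMapF2.eval` is the list of `polyVal`s of the output polynomials. [DvirGutfreundRothblumVadhan2010, §2] -/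
theorem eval_eq_map_polyVal (P : PolyMapF2 n) (x : Fin n → ZMod 2) :
    P.eval x = P.map fun p => polyVal p x := rfl

/-- Constants have degree `≤ 2`. [folklore] -/
theorem isDeg2_const {G : Type*} [AddCommGroup G] (c : ZMod 2) : IsDeg2 (fun _ : G => c) := by
  intro x a b d
  ring_nf
  reduce_mod_char

/-- Functions that agree everywhere have the same degree bound. [folklore] -/
theorem IsDeg2.congr {G : Type*} [AddCommGroup G] {f g : G → ZMod 2} (hf : IsDeg2 f)
    (h : ∀ x, g x = f x) : IsDeg2 g := by
  intro x a b d
  simp only [h]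
  exact hf x a b d

/-- The degree bound transports along additive maps. [folklore] -/
theorem IsDeg2.comp_addMonoidHom {G H : Type*} [AddCommGroup G] [AddCommGroup H] {f : H → ZMod 2}
    (hf : IsDeg2 f) (φ : G →+ H) : IsDeg2 (fun x => f (φ x)) := by
  intro x a b d
  simp only [map_add]
  exact hf (φ x) (φ a) (φ b) (φ d)

/-- `F₂`-multiples preserve the degree bound. [folklore] -/
theorem isDeg2_smul {G : Type*} [AddCommGroup G] (u : ZMod 2) {f : G → ZMod 2} (hf : IsDeg2 f) :
    IsDeg2 (fun x => u * f x) := by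
  intro x a b d
  have h := hf x a b d
  linear_combination u * h

/-- Finite sums preserve the degree bound. [folklore] -/
theorem isDeg2_sum {G : Type*} [AddCommGroup G] {ι : Type*} (S : Finset ι) (f : ι → G → ZMod 2)
    (hf : ∀ i ∈ S, IsDeg2 (f i)) : IsDeg2 (fun x => ∑ i ∈ S, f i x) := by
  classical
  induction S using Finset.induction_on with
  | empty => exact (isDeg2_const 0).congr fun x => by simp
  | insert i S hi ih =>
    have h1 : IsDeg2 (f i) := hf i (Finset.mem_insert_self i S)
    have h2 := ih fun j hj => hf j (Finset.mem_insert_of_mem hj)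
    exact (deg2_add h1 h2).congr fun x => by rw [Finset.sum_insert hi]

/-- Coordinates have degree `≤ 2`. [folklore] -/
theorem isDeg2_coord (i : Fin n) : IsDeg2 (fun x : Fin n → ZMod 2 => x i) := by
  intro x a b d
  simp only [Pi.add_apply]
  ring_nf
  reduce_mod_char

/-- Products of two coordinates have degree `≤ 2`. [MacWilliamsSloane1977, Ch. 13 §3] -/
theorem isDeg2_mul_coord (i j : Fin n) : IsDeg2 (fun x : Fin n → ZMod 2 => x i * x j) := by
  intro x a b d
  simp only [Pi.add_apply]
  ring_nf
  reduce_mod_char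

/-- A monomial of length `≤ 2` has degree `≤ 2`. [MacWilliamsSloane1977, Ch. 13 §3] -/
theorem isDeg2_monomial : ∀ (μ : List (Fin n)), μ.length ≤ 2 →
    IsDeg2 (fun x : Fin n → ZMod 2 => (μ.map x).prod)
  | [], _ => (isDeg2_const 1).congr fun x => by simp
  | [i], _ => (isDeg2_coord i).congr fun x => by simp
  | [i, j], _ => (isDeg2_mul_coord i j).congr fun x => by simp
  | _ :: _ :: _ :: l, h => by simp at h

/-- **Every output of a sparse quadratic map has degree `≤ 2`** (all third derivatives vanish), i.e.
`PolyMapF2.DegLE 2` implies `IsDeg2` coordinatewise. [MacWilliamsSloane1977, Ch. 13 §3] -/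
theorem isDeg2_polyVal : ∀ (p : List (List (Fin n))), (∀ μ ∈ p, μ.length ≤ 2) → IsDeg2 (polyVal p)
  | [], _ => (isDeg2_const 0).congr fun x => by simp [polyVal]
  | μ :: p, hp => by
    have h1 := isDeg2_monomial μ (hp μ (by simp))
    have h2 := isDeg2_polyVal p (fun ν hν => hp ν (by simp [hν]))
    exact (deg2_add h1 h2).congr fun x => by simp [polyVal]

/-- `PolyMapF2.DegLE 2 P` gives `IsDeg2` for every output polynomial of `P`. [MacWilliamsSloane1977, Ch. 13 §3] -/
theorem isDeg2_of_degLE_two {P : PolyMapF2 n} (hP : P.DegLE 2) {p : List (List (Fin n))} (hp : p ∈ P) :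
    IsDeg2 (polyVal p) :=
  isDeg2_polyVal p (hP p hp)

/-- The gadget's variable space `F₂³ × F₂ˢ` mapped onto `F₂^{3+s}` by appending the blocks (the monomial's
variables `ξ` become variables `0,1,2`, the fresh variables `w` become `3,…,3+s−1`), as an additive map. -/
def appendHom (s : ℕ) : ((Fin 3 → ZMod 2) × (Fin s → ZMod 2)) →+ (Fin (3 + s) → ZMod 2) where
  toFun y := Fin.append y.1 y.2
  map_zero' := by
    funext i
    refine Fin.addCases (fun i => ?_) (fun j => ?_) i <;> simp
  map_add' y y' := by
    funext i
    refine Fin.addCases (fun i => ?_) (fun j => ?_) i <;> simp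

/-- Under `appendHom`, variable `castAdd s i` (`i < 3`) is `ξᵢ`. [folklore] -/
theorem appendHom_castAdd {s : ℕ} (y : ((Fin 3 → ZMod 2) × (Fin s → ZMod 2))) (i : Fin 3) : appendHom s y (Fin.castAdd s i) = y.1 i := by
  show Fin.append y.1 y.2 (Fin.castAdd s i) = y.1 i
  simp

/-- Under `appendHom`, variable `natAdd 3 j` is the fresh variable `wⱼ`. [folklore] -/
theorem appendHom_natAdd {s : ℕ} (y : ((Fin 3 → ZMod 2) × (Fin s → ZMod 2))) (j : Fin s) : appendHom s y (Fin.natAdd 3 j) = y.2 j := by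
  show Fin.append y.1 y.2 (Fin.natAdd 3 j) = y.2 j
  simp

/-- **No entropy-exact local quadratic gadget, sparse form.**  For sparse quadratic polynomials over `F₂` in the
`3 + s` variables `(ξ, w)` — one replacement polynomial `Ap` and `t` appended outputs `Bp i`, every monomial of
length `≤ 2` — it is impossible that the outputs are jointly independent of `ξ` (every fibre equidistributed over
the eight `ξ`-slices) while `Ap = ξ₀ξ₁ξ₂ + c(Bp)` pointwise.  By `Disproof.lean` THEOREM 10.1 these two
properties are forced on any gadget that is entropy-exact on seven explicit test maps, so no quadratic gadget
replaces a cubic monomial with a map-independent entropy offset. [this file] -/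
theorem no_sparse_quadratic_gadget (s t : ℕ) (Ap : List (List (Fin (3 + s))))
    (Bp : Fin t → List (List (Fin (3 + s))))
    (hA : ∀ μ ∈ Ap, μ.length ≤ 2) (hB : ∀ i, ∀ μ ∈ Bp i, μ.length ≤ 2)
    (c : (Fin t → ZMod 2) → ZMod 2)
    (hind : ∀ (b : Fin t → ZMod 2) (ξ₀ : Fin 3 → ZMod 2),
      8 * ((fib (fun y : ((Fin 3 → ZMod 2) × (Fin s → ZMod 2)) => fun i => polyVal (Bp i) (appendHom s y)) b).filter
            fun y => y.1 = ξ₀).card =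
        (fib (fun y : ((Fin 3 → ZMod 2) × (Fin s → ZMod 2)) => fun i => polyVal (Bp i) (appendHom s y)) b).card)
    (henc : ∀ y : ((Fin 3 → ZMod 2) × (Fin s → ZMod 2)),
      polyVal Ap (appendHom s y) = cube y.1 + c (fun i => polyVal (Bp i) (appendHom s y))) :
    False := by
  refine no_xi_independent_quadratic_encoding s t (fun y i => polyVal (Bp i) (appendHom s y))
    (fun y => polyVal Ap (appendHom s y)) c
    ((isDeg2_polyVal Ap hA).comp_addMonoidHom (appendHom s)) (fun u => ?_) hind (fun y => ?_)
  · have h := (isDeg2_sum Finset.univ (fun i x => u i * polyVal (Bp i) x)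
      (fun i _ => isDeg2_smul (u i) (isDeg2_polyVal (Bp i) (hB i)))).comp_addMonoidHom (appendHom s)
    exact h.congr fun y => by simp [dot]
  · rw [henc y]
    ring_nf
    reduce_mod_char

end Sparse

end Summit.PneNP.PneNP.Theorems.PeaTwoMemBPP.Negative
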